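import Summits.AnomalousDissipation.AnomalousDissipation.Theorems.SawtoothPulseCascadeK1LocalisedCascadeLedgerThinClose

/-!
# K1loc, line `Spectral` / SeqCone — helper: `K1Localised` FROM RELEASED ENERGY OF THE INVISCID ITERATES (thin start, S-D target)

Helper file of the prover lane on the crux `K1LocalisedCascade` (stmt-AnomalousDissipation-19491), route
`SawtoothPulseCascade` (S-B/S-C assembly seat).  `…LedgerThinClose.k1Localised_of_thin_iterate_bound` closes `K1Localised P (γ²−3)`
(shape P) from ONE uniform bound `√(Σ μ_n²|𝓕a_n|²) ≤ q < ‖datum‖` on the TRACKED start energy of the explicit inviscid iterates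
`a_n`, `μ_n` the start symbol with thin tracked radius `c(γ²−3)^n`.  The symbol `μ_n` is smooth but VANISHES IDENTICALLY on the
released core `G_n = {|k₀| ≥ (1+1/250)c(γ²−3)^n} ∩ {γ|k₁| ≤ 13/10·|k₀|} ∩ {|k|_∞ ≤ R_n}` (`symProdS_eq_zero_of_released`), and
`|μ_n| ≤ 1`; by Parseval and the measure preservation of the pulse maps (`‖a_n‖ = ‖datum‖`) the tracked energy is at most
`‖datum‖² − Σ_{k∈S}|𝓕a_n(k)|²` for any finite `S ⊆ G_n` (`tsum_symbol_sq_le_scalarL2Sq_sub`).  Hence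
**`k1Localised_of_thin_released_energy`**: if for ONE `e > 0`, ANY `c > 0` and ALL `n ≥ i₁` some finite set of released modes carries
energy `≥ e` of `a_n`, then `K1Localised P (γ²−3)` — the S-D target of the thin chain as a LOWER bound on released energy (every
flat cell of `a_n` has carrier frequency `≥ (γ²−3)^n > (1+1/250)c(γ²−3)^n` for `c < 250/251`, inside the invariant cone).
No definitions; nothing about the crux at `δ₀ = ¼`. [cite: DEIJ2022, (1.2)–(1.3)] [cite: ElgindiLissMattingly2025, §1.2.2 and §3.1]
[cite: Grafakos2014, Prop. 3.2.7 (3) (Parseval)] [problem: turb]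
-/

-- `Summit.<Summit>.<Problem>`: single-conjunct summit, the duplicate namespace segment is deliberate.
set_option linter.dupNamespace false

noncomputable section

namespace Summit.AnomalousDissipation.AnomalousDissipation.Theorems.SawtoothPulseCascade.K1Ledger.From

open MeasureTheory Set Filter Topology UnitAddTorus Function
open scoped ENNReal
open Literature.Analysis Literature.Analysis.FunctionSpaces Literature.Analysis.FunctionSpaces.Torus Literature.Analysis.FluidPDE
open Literature.Analysis.FluidPDE.ShearStage
open Literature.Analysis.FluidPDE.SawtoothCascade Literature.Analysis.FluidPDE.SawtoothCascade.CascadeParams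
open Summit.AnomalousDissipation.AnomalousDissipation.Theorems.SawtoothPulseCascade.K1Symbol
open Summit.AnomalousDissipation.AnomalousDissipation.Theorems.SawtoothPulseCascade.K1Start
open Summit.AnomalousDissipation.AnomalousDissipation.Theorems.SawtoothPulseCascade.K1Ledger


/-! ## `K1Localised` from a uniform LOWER bound on the RELEASED energy of the inviscid iterates -/

/-- **The start symbol vanishes on the released core.**  For the tracked product symbol
`1 − gˢ_L·g^env_{R,w}` (`gˢ_L = sT((|k_h|−L)/(L/250))·(1 − sT((γ|k_v| − 13/10·|k_h|)/(L/20)))`): if `|k_h| ≥ (1+1/250)L`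
(radial cut-off saturated), `γ|k_v| ≤ 13/10·|k_h|` (inside the unstable cone) and `|k_h|, |k_v| ≤ R` (inside the envelope), the
symbol is EXACTLY `0` — the mode is released. [cite: ElgindiLissMattingly2025, §1.2.2 (the unstable cone)] -/
theorem symProdS_eq_zero_of_released {γ L R w : ℝ} (hL : 0 < L) (hw : 0 < w) {kh kv : ℤ}
    (h0 : (1 + 1 / 250) * L ≤ |(kh : ℝ)|) (h1 : γ * |(kv : ℝ)| ≤ 13 / 10 * |(kh : ℝ)|) (h2 : |(kh : ℝ)| ≤ R)
    (h3 : |(kv : ℝ)| ≤ R) :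
    1 - Real.smoothTransition ((|(kh : ℝ)| - L) / (1 / 250 * L)) *
        (1 - Real.smoothTransition ((γ * |(kv : ℝ)| - 13 / 10 * |(kh : ℝ)|) / (1 / 20 * L))) *
      ((1 - Real.smoothTransition ((|(kh : ℝ)| - R) / w)) * (1 - Real.smoothTransition ((|(kv : ℝ)| - R) / w))) = 0 := by
  have e1 : Real.smoothTransition ((|(kh : ℝ)| - L) / (1 / 250 * L)) = 1 :=
    Real.smoothTransition.one_of_one_le (by rw [le_div_iff₀ (by positivity)]; linarith)
  have e2 : Real.smoothTransition ((γ * |(kv : ℝ)| - 13 / 10 * |(kh : ℝ)|) / (1 / 20 * L)) = 0 :=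
    Real.smoothTransition.zero_of_nonpos (div_nonpos_of_nonpos_of_nonneg (by linarith) (by positivity))
  have e3 : Real.smoothTransition ((|(kh : ℝ)| - R) / w) = 0 :=
    Real.smoothTransition.zero_of_nonpos (div_nonpos_of_nonpos_of_nonneg (by linarith) hw.le)
  have e4 : Real.smoothTransition ((|(kv : ℝ)| - R) / w) = 0 :=
    Real.smoothTransition.zero_of_nonpos (div_nonpos_of_nonpos_of_nonneg (by linarith) hw.le)
  rw [e1, e2, e3, e4]; norm_num

/-- **Tracked energy ≤ total energy − released energy.**  For a continuous real scalar `θ`, a real symbol `|μ| ≤ 1` and a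
finite set `S` of modes on which `μ = 0`:  `Σ' μ(k)²|𝓕θ(k)|² ≤ ‖θ‖²_{L²} − Σ_{k∈S} |𝓕θ(k)|²` (Parseval).
[cite: Grafakos2014, Prop. 3.2.7 (3) (Parseval)] -/
theorem tsum_symbol_sq_le_scalarL2Sq_sub {θ : UnitAddTorus (Fin 2) → ℝ} (hθ : Continuous θ) (μ : (Fin 2 → ℤ) → ℝ)
    (hμ1 : ∀ k, |μ k| ≤ 1) (S : Finset (Fin 2 → ℤ)) (hμS : ∀ k ∈ S, μ k = 0) :
    ∑' k, μ k ^ 2 * ‖mFourierCoeff (fun x => (θ x : ℂ)) k‖ ^ 2 ≤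
      Torus.scalarL2Sq θ - ∑ k ∈ S, ‖mFourierCoeff (fun x => (θ x : ℂ)) k‖ ^ 2 := by
  classical
  set cc : (Fin 2 → ℤ) → ℝ := fun k => ‖mFourierCoeff (fun x => (θ x : ℂ)) k‖ ^ 2 with hcc
  have hcc0 : ∀ k, 0 ≤ cc k := fun k => by positivity
  have hP : HasSum cc (Torus.scalarL2Sq θ) := SpectralLeakage.hasSum_sq_norm_mFourierCoeff_scalarL2Sq hθ
  have hS : HasSum (fun k => if k ∈ S then cc k else 0) (∑ k ∈ S, cc k) := by
    have h : HasSum (fun k => if k ∈ S then cc k else 0) (∑ k ∈ S, if k ∈ S then cc k else 0) :=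
      hasSum_sum_of_ne_finset_zero (fun k hk => if_neg hk)
    have e : ∑ k ∈ S, (if k ∈ S then cc k else 0) = ∑ k ∈ S, cc k :=
      Finset.sum_congr rfl fun k hk => if_pos hk
    rwa [e] at h
  have hsub : HasSum (fun k => cc k - if k ∈ S then cc k else 0) (Torus.scalarL2Sq θ - ∑ k ∈ S, cc k) := hP.sub hS
  have hμ2 : ∀ k, μ k ^ 2 ≤ 1 := fun k => by
    have h := hμ1 k
    rw [← sq_abs]; nlinarith [abs_nonneg (μ k)]
  have hle : ∀ k, μ k ^ 2 * cc k ≤ cc k - if k ∈ S then cc k else 0 := by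
    intro k
    by_cases hk : k ∈ S
    · rw [if_pos hk, hμS k hk]; simp
    · rw [if_neg hk, sub_zero]
      exact mul_le_of_le_one_left (hcc0 k) (hμ2 k)
  have hsum : Summable (fun k => μ k ^ 2 * cc k) :=
    Summable.of_nonneg_of_le (fun k => mul_nonneg (sq_nonneg _) (hcc0 k))
      (fun k => mul_le_of_le_one_left (hcc0 k) (hμ2 k)) hP.summable
  exact hasSum_le hle hsum.hasSum hsub

section Cascade

variable (P : CascadeParams)

/-- **`K1Localised P (γ² − 3)` from a uniform LOWER BOUND on the RELEASED energy of the inviscid iterates** (the S-D target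
of the thin chain in its most concrete form).  Shape P, `L_min ≥ 1000`, ANY `c > 0`: if for ONE `e > 0` and ALL `n ≥ i₁`
some finite set `S_n` of RELEASED modes — `|k₀| ≥ (1+1/250)·c(γ²−3)^n`, `γ|k₁| ≤ 13/10·|k₀|`, `|k₀|, |k₁| ≤ R_n = 2c(γ²−3)^n(Γ/ρ₀)^n`
— carries energy `Σ_{k∈S_n} |𝓕a_n(k)|² ≥ e` of the explicit inviscid iterate `a_n`, then `K1Localised P (γ² − 3)`.
(Parseval and measure preservation: the tracked start energy is then `≤ ‖datum‖² − e`, a uniform first good piece with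
`q = √(‖datum‖² − e) < ‖datum‖`.) [cite: DEIJ2022, (1.2)–(1.3)] [cite: ElgindiLissMattingly2025, §1.2.2 and §3.1] -/
theorem k1Localised_of_thin_released_energy (hγ : 5 ≤ P.γ) (hγ' : P.γ ≤ 8) (hδ₀ : 0 < P.δ₀) (hδ₀' : P.δ₀ ≤ 1 / 4)
    (hd : P.d = 2) (hN₀ : P.N₀ = 1) (hρN : P.ρN = 2) {Lm : ℝ} (hLm : 1000 ≤ Lm) (hE : 0 < Torus.scalarL2Sq datum)
    (a b : ℕ → UnitAddTorus (Fin 2) → ℝ) (has : ∀ j, IsSmooth (a j)) (h0 : a 0 = datum)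
    (hb : ∀ j, b j = a j ∘ shearMap 0 1 (amp ⟨P.U j, P.U_periodic j, P.contDiff_U (P.δ_pos hδ₀ (by rw [hd]; norm_num) j)⟩ P.γ))
    (hab : ∀ j, a (j + 1) = b j ∘ shearMap 1 0 (amp ⟨P.U j, P.U_periodic j, P.contDiff_U (P.δ_pos hδ₀ (by rw [hd]; norm_num) j)⟩ P.γ))
    {c : ℝ} (hc : 0 < c) {e : ℝ} (he : 0 < e) {i₁ : ℕ}
    (hrel : ∀ n : ℕ, i₁ ≤ n → ∃ S : Finset (Fin 2 → ℤ),
      (∀ k ∈ S, (1 + 1 / 250) * (c * (P.γ ^ 2 - 3) ^ n) ≤ |((k 0 : ℤ) : ℝ)| ∧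
        P.γ * |((k 1 : ℤ) : ℝ)| ≤ 13 / 10 * |((k 0 : ℤ) : ℝ)| ∧
        |((k 0 : ℤ) : ℝ)| ≤ 2 * (c * (P.γ ^ 2 - 3) ^ n / ((P.γ ^ 2 - 5 / 2) / (1 + 1 / 250) ^ 2 - 1 / (2 * (1 + 1 / 250) * Lm)) ^ n) * ((1 + P.γ) ^ 2 + 1) ^ n ∧
        |((k 1 : ℤ) : ℝ)| ≤ 2 * (c * (P.γ ^ 2 - 3) ^ n / ((P.γ ^ 2 - 5 / 2) / (1 + 1 / 250) ^ 2 - 1 / (2 * (1 + 1 / 250) * Lm)) ^ n) * ((1 + P.γ) ^ 2 + 1) ^ n) ∧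
      e ≤ ∑ k ∈ S, ‖mFourierCoeff (fun x => (a n x : ℂ)) k‖ ^ 2) :
    K1Localised P (P.γ ^ 2 - 3) := by
  have hγ0 : 0 < P.γ := by linarith
  have hd0 : 0 < P.d := by rw [hd]; norm_num
  have hr0 : 0 < P.γ ^ 2 - 3 := by nlinarith
  have hqE : Real.sqrt (Torus.scalarL2Sq datum - e) < Real.sqrt (Torus.scalarL2Sq datum) := by
    rw [Real.sqrt_lt' (Real.sqrt_pos.2 hE), Real.sq_sqrt hE.le]; linarith
  refine k1Localised_of_thin_iterate_bound P hγ hγ' hδ₀ hδ₀' hd hN₀ hρN hLm hE a b has h0 hb hab hc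
    (Real.sqrt_nonneg _) hqE (i₁ := i₁) ?_
  intro n hn
  obtain ⟨S, hS, heS⟩ := hrel n hn
  have hL : 0 < c * (P.γ ^ 2 - 3) ^ n := by positivity
  have hw : 0 < c * (P.γ ^ 2 - 3) ^ n / (20 * P.γ * (1 + 1 / 250)) := by positivity
  have hEn : Torus.scalarL2Sq (a n) = Torus.scalarL2Sq datum := by
    have h := integral_sq_iterate_eq P hδ₀ hd0 a b hb hab n
    rw [h0] at h
    exact h
  refine Real.sqrt_le_sqrt ((tsum_symbol_sq_le_scalarL2Sq_sub (has n).continuous _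
    (fun k => abs_symProdS_le_one P.γ (1 / 250) (1 / 20) (13 / 10) (c * (P.γ ^ 2 - 3) ^ n)
      (2 * (c * (P.γ ^ 2 - 3) ^ n / ((P.γ ^ 2 - 5 / 2) / (1 + 1 / 250) ^ 2 - 1 / (2 * (1 + 1 / 250) * Lm)) ^ n) * ((1 + P.γ) ^ 2 + 1) ^ n)
      (c * (P.γ ^ 2 - 3) ^ n / (20 * P.γ * (1 + 1 / 250))) (k 0) (k 1))
    S (fun k hk => ?_)).trans ?_)
  · obtain ⟨hk0, hk1, hk2, hk3⟩ := hS k hk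
    exact symProdS_eq_zero_of_released hL hw hk0 hk1 hk2 hk3
  · rw [hEn]; linarith

end Cascade

end Summit.AnomalousDissipation.AnomalousDissipation.Theorems.SawtoothPulseCascade.K1Ledger.From
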